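import Summits.HodgeConjecture.CorCM.MultiFieldWeilCoprimeOrbits
import Summits.HodgeConjecture.CorCM.MultiFieldWeilHodge
import HarnessLib

/-!
# MULTI-FIELD WEIL ENGINE — ANY NUMBER of CM fields of PAIRWISE COPRIME relative degrees over `k`, ONE-MEMBER types: joint transitivity of the realised tuples is
# AUTOMATIC, hence the defect law, hence the Hodge conjecture for every product of copies of `E, B_1, …, B_r` GIVEN ONLY the single-slot Weil spaces

Cell `pub-hodgecm2` (COR-CM), seat b30 gen 29 (2026-08-24); count-neutral own lane MULTI-FIELD WEIL ENGINE (stem `MultiFieldWeil*`), sequel of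
`CorCM/MultiFieldWeilCoprimeOrbits.lean` (the `r`-fold counting lemma) and `CorCM/MultiFieldWeilHodge.lean` (the generic headline).  Theorems only; no definition, no
named fact, no `sorry`.  HONEST FRAMING: the headline below is CONDITIONAL on the displayed Weil-space hypotheses `hW m` (one abelian variety `B_m × E^{n_m − 2}` of Weil
type per field; Markman's theorems discharge them for `n_m ∈ {3, 4}` — gen 28ʼs `CorCM/MultiFieldWeilMarkman.lean`); `HC_CM` is NOT proved and not asserted.

* §1 `inv_mem_realisedTuples` (a finite product-closed set of tuples is inverse-closed), `realisedTuples_nonempty`, **`transitive_realisedTuples`** (`Aut(ℂ)` is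
  transitive on the `τ`-fibre of every slot — `ZarhinLie.exists_ringEquiv_complex_comp_eq`, NO Galois hypothesis);
* §2 `preG_singleton`, **`orbitG_singleton_eq`**, `card_orbitG_singleton` (the orbit of a one-member position set is the set of all `n_m` singletons);
* §3 **`jointTransitiveG_realisedTuples_of_coprime`** — `n_m` pairwise coprime ⟹ the realised tuples move every tuple of points to the base tuple (gen 26ʼs
  `SexticOcticWeil.exists_ringEquiv_comp_eq_pair` for ANY number of fields), and **`exists_hasDefectsG_realisedTuples_of_coprime_oneMember`** (`hdef`, `c_m = n_m − 2`);
* §4 HEADLINE **`hodgeConjectureFor_biproduct_comp_of_coprime_oneMember`**: `E ⊨ (k; {τ})`, `B_m ⊨ (K_m; Φ_m)` with ONE member of `Φ_m` over `τ`, the `n_m = [K_m : k]`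
  PAIRWISE COPRIME: the Hodge conjecture for EVERY `⨁_j A(κ j)` (all products of copies of `E, B_1, …, B_r`, any order) GIVEN the Weil spaces of the
  `B_m ⊞ E^{n_m − 2}` — i.e. the Hodge rings of all these products are generated by divisors and single-slot Weil classes; `…of_avDominatedBy…` for everything
  dominated.  Instances: `(n_1, n_2) = (3, 4)` is gen 26ʼs `SexticOcticWeil` headline (mod Markman 4 + 6); `(3, 4, 5·)`, `(3, 5)`, `(4, 5)`, `(3, 4, 5, 7, …)` are
  conditional on the Weil spaces of the eightfold `B × E³` etc.
[cite: DixonMortimer1996, §1.6 and §2.1] [cite: Shimura1998, §18.2 Lemma (i)] [cite: MoonenZarhin1995Duke, Thm. 2.4] [cite: Pohlmann1968, Thm 1]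
[cite: Milne2020HodgeClassesAV, 1.2 (a) and Thm. 1] [cite: MumfordAV1970, §19]

## References
* [DixonMortimer1996] J. D. Dixon, B. Mortimer, *Permutation Groups*, GTM 163, §1.6, §2.1.  [Shimura1998] G. Shimura, *Abelian varieties with CM and modular
  functions*, §18.2 Lemma (i).  [MoonenZarhin1995Duke] B. Moonen, Yu. Zarhin, Duke Math. J. 77 (1995), Thm. 2.4.  [Pohlmann1968] H. Pohlmann, Ann. of Math. 88
  (1968), Thm 1.  [Milne2020HodgeClassesAV] J. S. Milne, arXiv:2010.08857, 1.2 (a), Thm. 1.  [MumfordAV1970] D. Mumford, *Abelian Varieties*, §19.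
-/

noncomputable section

open CategoryTheory CategoryTheory.Limits NumberField

namespace Summit.HodgeConjecture.CorCM.MultiFieldWeil

open Finset
open Literature.AlgebraicGeometry Literature.AlgebraicGeometry.Motives Literature.AlgebraicGeometry.HodgeTheory
open Literature.AlgebraicGeometry.ComplexMultiplication (IsCMTypeRealisation)
open Literature.AlgebraicTopology.SingularHomology
open Literature.NumberTheory.ComplexMultiplication
open Summit.HodgeConjecture.CorCM.Census.MultiFieldWeil

open scoped Classical

/-! ## §1 The realised tuples: inverses, non-emptiness, transitivity on every fibre -/

section Realised

variable {I : Type} {r : ℕ} {Kf : I → Type} [∀ i, Field (Kf i)] {i₀ : I} {is : Fin r → I} {n : Fin r → ℕ}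
  {e : ∀ m : Fin r, (Kf (is m) →+* ℂ) ≃ Fin (n m) × Bool} {τ : Kf i₀ →+* ℂ} {im : ∀ m : Fin r, Kf i₀ →+* Kf (is m)}

/-- **The realised tuples are closed under inverses**: `π⁻¹ = π^{2k−1}` for `k` the (finite, positive) order of `π`. [folklore] -/
theorem inv_mem_realisedTuples {π : PermsG n} (h : π ∈ realisedTuples e τ) : π⁻¹ ∈ realisedTuples e τ := by
  have hk : 0 < orderOf π := orderOf_pos π
  have hpow : π ^ (2 * orderOf π - 2 + 1) = π⁻¹ := by
    rw [eq_inv_iff_mul_eq_one, ← pow_succ, show 2 * orderOf π - 2 + 1 + 1 = 2 * orderOf π by omega, pow_mul', pow_orderOf_eq_one, one_pow]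
  rw [← hpow]
  exact pow_mem_realisedTuples e τ h _

variable (he_sign : ∀ (m : Fin r) (s : Kf (is m) →+* ℂ), (e m s).2 = true ↔ s.comp (im m) = τ)

include he_sign in
/-- The realised tuples are non-empty (the identity of `ℂ` realises one). [folklore] -/
theorem realisedTuples_nonempty : (realisedTuples e τ).Nonempty := by
  obtain ⟨π, hπ, -⟩ := exists_mem_realisedTuples_of_comp_tau_eq (e := e) he_sign (RingEquiv.refl ℂ) (RingHom.ext fun _ => rfl)
  exact ⟨π, hπ⟩

include he_sign in
/-- **`Aut(ℂ)` is transitive on the `τ`-fibre of every slot, through realised tuples**: for `a, b : Fin (n m)` some realised tuple has `π m a = b` (an automorphism of `ℂ`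
carrying `(e m)⁻¹(a,+)` to `(e m)⁻¹(b,+)` exists since `K_m` is countable, and it fixes `τ`). NO Galois hypothesis. [cite: Shimura1998, §18.2 Lemma (i)] -/
theorem transitive_realisedTuples [∀ i, NumberField (Kf i)] (m : Fin r) (a b : Fin (n m)) : ∃ π ∈ realisedTuples e τ, π m a = b := by
  haveI : Countable (Kf (is m)) := Countable.of_equiv _ (Module.finBasis ℚ (Kf (is m))).equivFun.toEquiv.symm
  obtain ⟨ρ, hρ⟩ := ZarhinLie.exists_ringEquiv_complex_comp_eq ((e m).symm (a, true)) ((e m).symm (b, true))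
  have hab : (ρ : ℂ →+* ℂ).comp ((e m).symm (a, true)) = (e m).symm (b, true) := RingHom.ext fun z => hρ z
  have hρτ : (ρ : ℂ →+* ℂ).comp τ = τ := by
    have ha' : ((e m).symm (a, true)).comp (im m) = τ := (he_sign m _).1 (by rw [Equiv.apply_symm_apply])
    have hb' : ((e m).symm (b, true)).comp (im m) = τ := (he_sign m _).1 (by rw [Equiv.apply_symm_apply])
    calc (ρ : ℂ →+* ℂ).comp τ = ((ρ : ℂ →+* ℂ).comp ((e m).symm (a, true))).comp (im m) := by rw [RingHom.comp_assoc, ha']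
      _ = τ := by rw [hab, hb']
  obtain ⟨π, hπ, hπρ⟩ := exists_mem_realisedTuples_of_comp_tau_eq (e := e) he_sign ρ hρτ
  refine ⟨π, hπ, ?_⟩
  have h := hπρ m a
  rw [hab] at h
  exact ((Prod.mk.inj ((e m).symm.injective h)).1).symm

end Realised

/-! ## §2 The orbit of a one-member position set is the set of all singletons -/

section Orbit

variable {r : ℕ} {n : Fin r → ℕ} {R : Finset (PermsG n)} {P : ∀ m : Fin r, Finset (Fin (n m))}

/-- `σ⁻¹{q} = {σ⁻¹ q}`. [folklore] -/
theorem preG_singleton {k : ℕ} (σ : Equiv.Perm (Fin k)) (q : Fin k) : preG σ {q} = {σ.symm q} := by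
  ext a
  rw [mem_preG, Finset.mem_singleton, Finset.mem_singleton, Equiv.apply_eq_iff_eq_symm_apply]

/-- **The orbit of a singleton position set under a slot-transitive `R` is the set of all singletons.** [cite: DixonMortimer1996, §1.6] -/
theorem orbitG_singleton_eq {m : Fin r} {q : Fin (n m)} (hP : P m = {q}) (htrans : ∀ a b : Fin (n m), ∃ π ∈ R, π m a = b) :
    orbitG R P m = univ.image fun a : Fin (n m) => ({a} : Finset (Fin (n m))) := by
  ext Q
  rw [mem_orbitG, Finset.mem_image]
  constructor
  · rintro ⟨π, -, rfl⟩
    exact ⟨(π m).symm q, Finset.mem_univ _, by rw [hP, preG_singleton]⟩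
  · rintro ⟨a, -, rfl⟩
    obtain ⟨π, hπ, hπa⟩ := htrans a q
    refine ⟨π, hπ, ?_⟩
    rw [hP, preG_singleton, ← hπa, Equiv.symm_apply_apply]

/-- Its size is `n_m`. [folklore] -/
theorem card_orbitG_singleton {m : Fin r} {q : Fin (n m)} (hP : P m = {q}) (htrans : ∀ a b : Fin (n m), ∃ π ∈ R, π m a = b) :
    (orbitG R P m).card = n m := by
  rw [orbitG_singleton_eq hP htrans, Finset.card_image_of_injective _ Finset.singleton_injective, Finset.card_univ, Fintype.card_fin]

/-- All singletons lie in it (so it separates, `Census.MultiFieldWeil.sep_of_singletons`). [folklore] -/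
theorem singleton_mem_orbitG {m : Fin r} {q : Fin (n m)} (hP : P m = {q}) (htrans : ∀ a b : Fin (n m), ∃ π ∈ R, π m a = b) (a : Fin (n m)) :
    ({a} : Finset (Fin (n m))) ∈ orbitG R P m := by
  rw [orbitG_singleton_eq hP htrans]
  exact Finset.mem_image.2 ⟨a, Finset.mem_univ _, rfl⟩

end Orbit

/-! ## §3 Pairwise coprime relative degrees: joint transitivity and the defect law for the realised tuples -/

section Coprime

variable {I : Type} {r : ℕ} {Kf : I → Type} [∀ i, Field (Kf i)] [∀ i, NumberField (Kf i)] {i₀ : I} {is : Fin r → I} {n : Fin r → ℕ}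
  {e : ∀ m : Fin r, (Kf (is m) →+* ℂ) ≃ Fin (n m) × Bool} {τ : Kf i₀ →+* ℂ} {im : ∀ m : Fin r, Kf i₀ →+* Kf (is m)}
  (he_sign : ∀ (m : Fin r) (s : Kf (is m) →+* ℂ), (e m s).2 = true ↔ s.comp (im m) = τ)

include he_sign in
/-- **JOINT TRANSITIVITY IS AUTOMATIC for pairwise coprime relative degrees** (any number of fields): for `n_m` pairwise coprime, every tuple of embeddings `(x_m)_m` over `τ`
is carried to the base tuple `(p_m)_m` by ONE automorphism of `ℂ` — through the realised tuples.  The `r`-field form of gen 26ʼs `SexticOcticWeil.exists_ringEquiv_comp_eq_pair`.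
[cite: DixonMortimer1996, §1.6 and §2.1] [cite: Shimura1998, §18.2 Lemma (i)] -/
theorem jointTransitiveG_realisedTuples_of_coprime (hcop : ∀ m m' : Fin r, m ≠ m' → (n m).Coprime (n m')) (p : ∀ m : Fin r, Fin (n m)) :
    JointTransitiveG (realisedTuples e τ) p := by
  intro x
  have hmul : ∀ π ∈ realisedTuples e τ, ∀ π' ∈ realisedTuples e τ, π * π' ∈ realisedTuples e τ := fun π hπ π' hπ' => mul_mem_realisedTuples e τ hπ hπ'
  have hinv : ∀ π ∈ realisedTuples e τ, π⁻¹ ∈ realisedTuples e τ := fun π hπ => inv_mem_realisedTuples hπ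
  have htrans : ∀ (m : Fin r) (a b : Fin (n m)), ∃ π ∈ realisedTuples e τ, π m a = b := fun m a b => transitive_realisedTuples (e := e) he_sign m a b
  have hcard : ∀ m : Fin r, (orbitG (realisedTuples e τ) (fun m => {p m}) m).card = n m := fun m => card_orbitG_singleton rfl (htrans m)
  have hcop' : ∀ m m' : Fin r, m ≠ m' → ((orbitG (realisedTuples e τ) (fun m => {p m}) m).card).Coprime ((orbitG (realisedTuples e τ) (fun m => {p m}) m').card) := by
    intro m m' hmm'
    rw [hcard m, hcard m']
    exact hcop m m' hmm'
  obtain ⟨π, hπ, h⟩ := jointSetTransitiveG_orbitG_of_coprime hmul hinv (realisedTuples_nonempty (e := e) he_sign) hcop' (fun m => {x m})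
    fun m => singleton_mem_orbitG rfl (htrans m) (x m)
  refine ⟨π, hπ, fun m => ?_⟩
  have h1 := (h m (x m)).2 (Finset.mem_singleton_self _)
  exact Finset.mem_singleton.1 h1

include he_sign in
/-- **THE DEFECT LAW for the realised tuples of ANY NUMBER of CM fields of pairwise coprime relative degrees `n_m ≥ 2`, one-member types** (`c_m = n_m − 2`): the
hypothesis `hdef` of `MultiFieldWeil.hodgeConjectureFor_biproduct_comp_of_defectLawG`, NO Galois hypothesis and NO hypothesis relating the fields beyond coprimality.
[cite: MoonenZarhin1995Duke, Thm. 2.4] [cite: DixonMortimer1996, §2.1] -/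
theorem exists_hasDefectsG_realisedTuples_of_coprime_oneMember (hcop : ∀ m m' : Fin r, m ≠ m' → (n m).Coprime (n m')) (hn : ∀ m, 2 ≤ n m)
    {P : ∀ m : Fin r, Finset (Fin (n m))} (p : ∀ m : Fin r, Fin (n m)) (hP : ∀ m, P m = {p m})
    {α : Type} (v : α → PtG n) (T : Finset α) (hT : ModelBalancedG P (realisedTuples e τ) v T) :
    ∃ t : Fin r → ℤ, HasDefectsG (fun m => n m - 2) v T t :=
  exists_hasDefectsG_of_jointTransitiveG hP (jointTransitiveG_realisedTuples_of_coprime (e := e) he_sign hcop p) hn hT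

end Coprime

/-! ## §4 The headline: any number of fields of pairwise coprime relative degrees, given the single-slot Weil spaces -/

section Headline

variable {I : Type} {r : ℕ} {Kf : I → Type} [∀ i, Field (Kf i)] [∀ i, NumberField (Kf i)] [∀ i, IsCMField (Kf i)]
  {i₀ : I} {is : Fin r → I} {n : Fin r → ℕ} {τ : Kf i₀ →+* ℂ}
  {A : Fin (r + 1) → AbelianVariety ℂ} {Φ : ∀ j : Fin (r + 1), CMType (Kf (mfSlots i₀ is j))}
  {ι : ∀ j, 𝓞 (Kf (mfSlots i₀ is j)) →+* End (A j)}
  {θ : ∀ j, Kf (mfSlots i₀ is j) →+* Module.End ℂ (complexBetti (A j).X 1)}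

/-- **HEADLINE — ANY NUMBER OF CM FIELDS OF PAIRWISE COPRIME RELATIVE DEGREES, ONE-MEMBER TYPES.**  `k = Kf i₀` imaginary quadratic, `E = A 0 ⊨ (k; {τ})`
(`τ(δ) = i√d`), `B_m = A (m+1) ⊨ (K_m; Φ (m+1))` over CM fields `K_m ⊇ i_m(k)` of relative degrees `n_m = [K_m : k] ≥ 2` that are PAIRWISE COPRIME, each `Φ (m+1)` with
exactly ONE member over `τ` (read by the frame `e m` at position `p m`).  Then the Hodge conjecture holds for EVERY product of copies `⨁_j A(κ j)` — GIVEN, for each `m`,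
the Weil space of the single-slot part `B_m ⊞ E^{n_m − 2}` (`hW m`).  The defect law is AUTOMATIC (§3); the engine does the rest.  `HC_CM` is NOT asserted; for
`n_m ∈ {3, 4}` the `hW m` are Markman's theorems (`MultiFieldWeil.weilHyp_of_markman_fourfold/_sixfold_octic`), beyond that they are open.
[cite: Pohlmann1968, Thm 1] [cite: Milne2020HodgeClassesAV, 1.2 (a) and Thm. 1] [cite: MoonenZarhin1995Duke, Thm. 2.4] [cite: DixonMortimer1996, §2.1] -/
theorem hodgeConjectureFor_biproduct_comp_of_coprime_oneMember (p : ∀ m : Fin r, Fin (n m)) (hn : ∀ m, 2 ≤ n m)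
    (hcop : ∀ m m' : Fin r, m ≠ m' → (n m).Coprime (n m'))
    {N : ℕ} (κ : Fin N → Fin (r + 1)) (h2 : Module.finrank ℚ (Kf i₀) = 2) (im : ∀ m : Fin r, Kf i₀ →+* Kf (is m))
    {δ : 𝓞 (Kf i₀)} {d : ℕ} (hτ : τ (δ : Kf i₀) = Complex.I * (Real.sqrt d : ℂ))
    (hA : ∀ j, IsCMTypeRealisation (Φ j) (A j) (ι j) (θ j))
    (e : ∀ m : Fin r, (Kf (is m) →+* ℂ) ≃ Fin (n m) × Bool)
    (he_sign : ∀ (m : Fin r) (s : Kf (is m) →+* ℂ), (e m s).2 = true ↔ s.comp (im m) = τ)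
    (he_conj : ∀ (m : Fin r) (s : Kf (is m) →+* ℂ), e m (ComplexEmbedding.conjugate s) = ((e m s).1, !(e m s).2))
    (hΨ : ∀ σ : Kf i₀ →+* ℂ, σ ∈ (Φ 0).1 ↔ σ = τ)
    (hΦ : ∀ (m : Fin r) (s : Kf (is m) →+* ℂ), s ∈ (Φ m.succ).1 ↔ (e m s).2 = decide ((e m s).1 = p m))
    (hW : ∀ m : Fin r, weilClassesOf (⨁ fun i => A (partSlots (n m - 2) m i))
      (biproduct.map fun i => ι (partSlots (n m - 2) m i) (δfam im δ (partSlots (n m - 2) m i))) (n m - 1) d ≤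
      algebraicClasses (⨁ fun i => A (partSlots (n m - 2) m i)).X (n m - 1)) :
    HodgeConjectureFor (⨁ fun j => A (κ j)).dim (⨁ fun j => A (κ j)).X := by
  have hΦ' : ∀ (m : Fin r) (s : Kf (is m) →+* ℂ), s ∈ (Φ m.succ).1 ↔ (e m s).2 = decide ((e m s).1 ∈ ({p m} : Finset (Fin (n m)))) := by
    intro m s
    rw [hΦ m s, decide_eq_decide.2 Finset.mem_singleton]
  exact hodgeConjectureFor_biproduct_comp_of_defectLawG (is := is) (fun m => {p m}) (fun m => n m - 2) (fun m => n m - 1)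
    (fun m => by have := hn m; omega) (fun m => by have := hn m; omega) κ h2 im hτ hA e he_sign he_conj hΨ hΦ'
    (fun v T hT => exists_hasDefectsG_realisedTuples_of_coprime_oneMember (e := e) he_sign hcop hn p (fun _ => rfl) v T hT) hW

/-- **… and for every abelian variety DOMINATED by such a product** (isogeny images, abelian subvarieties, quotients). `HC_CM` is NOT asserted.
[cite: MumfordAV1970, §19] [cite: Pohlmann1968, Thm 1] -/
theorem hodgeConjectureFor_of_avDominatedBy_comp_of_coprime_oneMember (p : ∀ m : Fin r, Fin (n m)) (hn : ∀ m, 2 ≤ n m)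
    (hcop : ∀ m m' : Fin r, m ≠ m' → (n m).Coprime (n m'))
    {N : ℕ} (κ : Fin N → Fin (r + 1)) (h2 : Module.finrank ℚ (Kf i₀) = 2) (im : ∀ m : Fin r, Kf i₀ →+* Kf (is m))
    {δ : 𝓞 (Kf i₀)} {d : ℕ} (hτ : τ (δ : Kf i₀) = Complex.I * (Real.sqrt d : ℂ))
    (hA : ∀ j, IsCMTypeRealisation (Φ j) (A j) (ι j) (θ j))
    (e : ∀ m : Fin r, (Kf (is m) →+* ℂ) ≃ Fin (n m) × Bool)
    (he_sign : ∀ (m : Fin r) (s : Kf (is m) →+* ℂ), (e m s).2 = true ↔ s.comp (im m) = τ)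
    (he_conj : ∀ (m : Fin r) (s : Kf (is m) →+* ℂ), e m (ComplexEmbedding.conjugate s) = ((e m s).1, !(e m s).2))
    (hΨ : ∀ σ : Kf i₀ →+* ℂ, σ ∈ (Φ 0).1 ↔ σ = τ)
    (hΦ : ∀ (m : Fin r) (s : Kf (is m) →+* ℂ), s ∈ (Φ m.succ).1 ↔ (e m s).2 = decide ((e m s).1 = p m))
    (hW : ∀ m : Fin r, weilClassesOf (⨁ fun i => A (partSlots (n m - 2) m i))
      (biproduct.map fun i => ι (partSlots (n m - 2) m i) (δfam im δ (partSlots (n m - 2) m i))) (n m - 1) d ≤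
      algebraicClasses (⨁ fun i => A (partSlots (n m - 2) m i)).X (n m - 1))
    {X : AbelianVariety ℂ} (hX : Domination.AVDominatedBy X (⨁ fun j => A (κ j))) : HodgeConjectureFor X.dim X.X :=
  Domination.hodgeConjectureFor_of_avDominatedBy
    (hodgeConjectureFor_biproduct_comp_of_coprime_oneMember p hn hcop κ h2 im hτ hA e he_sign he_conj hΨ hΦ hW) hX

end Headline

end Summit.HodgeConjecture.CorCM.MultiFieldWeil

end
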